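import Mathlib
import Literature.MathematicalPhysics.QuantumLattice.WilsonDiracAP
import Summits.QuantumFields.QCD.Theorems.QuarksAsStableActionCriticalLineDiamagnetismStubTilingCellData

/-!
# Combinatorics of the reflection tiling read on the `2⁴` block
(helper for crux stmt-QuantumFields-9734, line `Sketch`, stub `stub_tilingCombinatorics`)

What.  On the even torus `(ℤ/2M)⁴` let `tile_c V` be the period-2 reflection tiling of the gauge field
`V` about the corner `c`, and let `W_c : Edge 4 2 → U(3)` be the tiling read at the sixteen
representatives `c + a`, `a ∈ (ℤ/2)⁴` (lifted into `ℤ/2M` by `val`).  We prove: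
(i) `W_c (x + μ̂, μ) = W_c (x, μ)⁻¹` for every block link;
(ii) the `96` plaquette deficits `3 - Re tr` of `W_c` on the `2⁴`-torus sum to `4` times the total
deficit of the `24` CELL plaquettes of `V` at `c` (base point `y` with `y_i = c_i`, `y_j = c_j` in the
plane `(i, j)` and transverse coordinates in `{c_ν, c_ν + 1}`).

How.  Everything is phrased for a block field `W` in NORMAL FORM (`TilingCellData.link_eq`):
`W (a, μ) = V (c + a, μ)` if `a_μ = 0` and `W (a, μ) = V (c + (a + e_μ), μ)⁻¹` if `a_μ = 1`.
(i) is a two-case check (`a + e_μ + e_μ = a` in `(ℤ/2)⁴`).  For (ii), (i) alone implies the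
REFLECTION IDENTITIES `hol W (a + î; i, j) = W(a,i)⁻¹ · (hol W (a; i, j))⁻¹ · W(a,i)` and
`hol W (a + ĵ; i, j) = W(a,j)⁻¹ · (hol W (a; i, j))⁻¹ · W(a,j)` (pure group algebra), so the plaquette
deficit is invariant under the two in-plane shifts of the base point (`Re tr` is invariant under
conjugation and under inversion on `U(3)`); halving the sum twice along these involutions gives
`Σ_{96} = 4 · Σ_{a_i = a_j = 0}`.  For `a_i = a_j = 0` the block holonomy IS the cell holonomy
`hol V (c + a; i, j)` (normal form, `c + (a + î) = (c + a) + î` when `a_i = 0`), and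
`(a; i, j) ↦ (c + a; i, j)` is a bijection from `{a_i = a_j = 0}` onto the cell plaquettes
(`Finset.sum_bij`; the cell Finset enters only through a membership characterisation, so that
decidability instances are matched by unification).
Sources: folklore lattice bookkeeping; sibling file `…StubTilingCellData` (normal form,
`trace_re_inv`, `val_offset`).  Pure theorem file.
-/

noncomputable section

open scoped BigOperators Classical Matrix ComplexConjugate
open Finset
open Literature.MathematicalPhysics.QuantumLattice Literature.MathematicalPhysics.QuantumFieldTheory
  Literature.Probability.LatticeModels

namespace Summit.QuantumFields.QCD.Cruxes.CriticalLineDiamagnetism.ChessboardCellGain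

namespace TilingCombinatorics

/-! ### Halving a sum along an involution -/

/-- If a bijection `φ` of a finite type exchanges `P` and `¬ P` and preserves `f`, then
`Σ f = 2 · Σ_{P} f`. -/
theorem sum_eq_two_mul_sum_ite {α : Type*} [Fintype α] (φ : α → α) (hφ : Function.Bijective φ)
    (P : α → Prop) [DecidablePred P] (hP : ∀ a, P (φ a) ↔ ¬P a) (f : α → ℝ)
    (hf : ∀ a, f (φ a) = f a) :
    ∑ a, f a = 2 * ∑ a, (if P a then f a else 0) := by
  have h : ∀ a, f a = (if P a then f a else 0) + (if P (φ a) then f (φ a) else 0) := fun a => by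
    by_cases ha : P a
    · rw [if_pos ha, if_neg (fun h => (hP a).1 h ha), add_zero]
    · rw [if_neg ha, if_pos ((hP a).2 ha), hf, zero_add]
  rw [Finset.sum_congr rfl fun a _ => h a, Finset.sum_add_distrib, two_mul]
  congr 1
  exact Fintype.sum_bijective φ hφ (fun a => if P (φ a) then f (φ a) else 0) _ fun _ => rfl

/-! ### Shifts on the `2⁴`-torus -/

/-- On `(ℤ/2)⁴`, shifting twice in the same direction is the identity. -/
theorem shift_shift_self (a : Site 4 2) (i : Fin 4) : Site.shift (Site.shift a i) i = a := by
  show a + Pi.single i 1 + Pi.single i 1 = a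
  rw [add_assoc, ← Pi.single_add, show (1 : ZMod 2) + 1 = 0 from by decide, Pi.single_zero,
    add_zero]

/-- Shifts of a site commute. -/
theorem shift_shift_comm {L : ℕ} (a : Site 4 L) (i j : Fin 4) :
    Site.shift (Site.shift a j) i = Site.shift (Site.shift a i) j := by
  show a + Pi.single j 1 + Pi.single i 1 = a + Pi.single i 1 + Pi.single j 1
  rw [add_right_comm]

/-! ### Reflection identities for a block field with `X (x + μ̂, μ) = X (x, μ)⁻¹` -/

section Reflection

variable {G : Type*} [Group G] {X : GaugeConfig 4 2 G}

/-- Shifting the base point along the FIRST axis of the plane conjugates the inverse holonomy: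
`hol (a + î; i, j) = X(a,i)⁻¹ · hol (a; i, j)⁻¹ · X(a,i)`. -/
theorem holonomy_shift_fst (hX : ∀ (x : Site 4 2) (μ : Fin 4), X (Site.shift x μ, μ) = (X (x, μ))⁻¹)
    (a : Site 4 2) (i j : Fin 4) :
    plaquetteHolonomy X (Site.shift a i) i j =
      (X (a, i))⁻¹ * (plaquetteHolonomy X a i j)⁻¹ * X (a, i) := by
  unfold plaquetteHolonomy
  rw [shift_shift_self a i, ← shift_shift_comm a i j, hX a i, hX (Site.shift a j) i]
  group

/-- Shifting the base point along the SECOND axis of the plane conjugates the inverse holonomy: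
`hol (a + ĵ; i, j) = X(a,j)⁻¹ · hol (a; i, j)⁻¹ · X(a,j)`. -/
theorem holonomy_shift_snd (hX : ∀ (x : Site 4 2) (μ : Fin 4), X (Site.shift x μ, μ) = (X (x, μ))⁻¹)
    (a : Site 4 2) (i j : Fin 4) :
    plaquetteHolonomy X (Site.shift a j) i j =
      (X (a, j))⁻¹ * (plaquetteHolonomy X a i j)⁻¹ * X (a, j) := by
  unfold plaquetteHolonomy
  rw [shift_shift_self a j, shift_shift_comm a i j, hX (Site.shift a i) j, hX a j]
  group

end Reflection

/-- `Re tr (u⁻¹ h⁻¹ u) = Re tr h` on `U(3)` (cyclicity of the trace and `Re tr h⁻¹ = Re tr h`). -/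
theorem trace_re_conj_inv (u h : Matrix.unitaryGroup (Fin 3) ℂ) :
    (((u⁻¹ * h⁻¹ * u : Matrix.unitaryGroup (Fin 3) ℂ) : Matrix (Fin 3) (Fin 3) ℂ)).trace.re =
      ((h : Matrix (Fin 3) (Fin 3) ℂ)).trace.re := by
  rw [mul_assoc, Matrix.UnitaryGroup.mul_val, Matrix.trace_mul_comm, ← Matrix.UnitaryGroup.mul_val,
    mul_inv_cancel_right]
  exact TilingCellData.trace_re_inv h

variable {W : GaugeConfig 4 2 (Matrix.unitaryGroup (Fin 3) ℂ)}

/-- The plaquette deficit of a block field with `W (x + μ̂, μ) = W (x, μ)⁻¹` is invariant under the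
shift of the base point along the first axis of the plane. -/
theorem deficit_shift_fst (hW : ∀ (x : Site 4 2) (μ : Fin 4), W (Site.shift x μ, μ) = (W (x, μ))⁻¹)
    (a : Site 4 2) (i j : Fin 4) :
    3 - (unitaryFundamentalRep (Fin 3) ℂ (plaquetteHolonomy W (Site.shift a i) i j)).trace.re =
      3 - (unitaryFundamentalRep (Fin 3) ℂ (plaquetteHolonomy W a i j)).trace.re := by
  simp only [unitaryFundamentalRep_apply]
  rw [holonomy_shift_fst hW, trace_re_conj_inv]

/-- The plaquette deficit of a block field with `W (x + μ̂, μ) = W (x, μ)⁻¹` is invariant under the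
shift of the base point along the second axis of the plane. -/
theorem deficit_shift_snd (hW : ∀ (x : Site 4 2) (μ : Fin 4), W (Site.shift x μ, μ) = (W (x, μ))⁻¹)
    (a : Site 4 2) (i j : Fin 4) :
    3 - (unitaryFundamentalRep (Fin 3) ℂ (plaquetteHolonomy W (Site.shift a j) i j)).trace.re =
      3 - (unitaryFundamentalRep (Fin 3) ℂ (plaquetteHolonomy W a i j)).trace.re := by
  simp only [unitaryFundamentalRep_apply]
  rw [holonomy_shift_snd hW, trace_re_conj_inv]

/-! ### Four-to-one: the block sum is four times the sum over `a_i = a_j = 0` -/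

/-- **Four-to-one.**  A function of the block plaquettes which is invariant under the two in-plane
shifts of the base point sums to four times its sum over the base points with vanishing in-plane
coordinates (halve twice along the involutions `a ↦ a + ĵ`, `a ↦ a + î`). -/
theorem sum_eq_four_mul_sum_filter (f : Plaquette 4 2 → ℝ)
    (hf1 : ∀ p : Plaquette 4 2, f (Site.shift p.1 p.2.1.1, p.2) = f p)
    (hf2 : ∀ p : Plaquette 4 2, f (Site.shift p.1 p.2.1.2, p.2) = f p) :
    ∑ p, f p = 4 * ∑ p ∈ univ.filter (fun p : Plaquette 4 2 => p.1 p.2.1.1 = 0 ∧ p.1 p.2.1.2 = 0), f p := by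
  have hφ : ∀ μ : {q : Fin 4 × Fin 4 // q.1 < q.2} → Fin 4,
      Function.Bijective (fun p : Plaquette 4 2 => ((Site.shift p.1 (μ p.2), p.2) : Plaquette 4 2)) :=
    fun μ => Function.Involutive.bijective fun p => by
      show ((Site.shift (Site.shift p.1 (μ p.2)) (μ p.2), p.2) : Plaquette 4 2) = p
      rw [shift_shift_self]
  have hP : ∀ (μ : {q : Fin 4 × Fin 4 // q.1 < q.2} → Fin 4) (p : Plaquette 4 2),
      Site.shift p.1 (μ p.2) (μ p.2) = 0 ↔ ¬p.1 (μ p.2) = 0 := fun μ p => by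
    rw [FreeDetFormula.shift_apply_self]
    exact (by decide : ∀ z : ZMod 2, z + 1 = 0 ↔ ¬z = 0) _
  -- halve along the second axis of the plane
  have h2 : ∑ p, f p = 2 * ∑ p : Plaquette 4 2, (if p.1 p.2.1.2 = 0 then f p else 0) :=
    sum_eq_two_mul_sum_ite _ (hφ fun s => s.1.2) (fun p : Plaquette 4 2 => p.1 p.2.1.2 = 0)
      (hP fun s => s.1.2) f hf2
  -- halve along the first axis of the plane
  have h1 : ∑ p : Plaquette 4 2, (if p.1 p.2.1.2 = 0 then f p else 0) =
      2 * ∑ p : Plaquette 4 2, (if p.1 p.2.1.1 = 0 then (if p.1 p.2.1.2 = 0 then f p else 0) else 0) :=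
    sum_eq_two_mul_sum_ite _ (hφ fun s => s.1.1) (fun p : Plaquette 4 2 => p.1 p.2.1.1 = 0)
      (hP fun s => s.1.1) _ fun p => by
        show (if Site.shift p.1 p.2.1.1 p.2.1.2 = 0 then f (Site.shift p.1 p.2.1.1, p.2) else 0) =
          if p.1 p.2.1.2 = 0 then f p else 0
        rw [FreeDetFormula.shift_apply_of_ne _ (ne_of_lt p.2.2).symm, hf1]
  rw [h2, h1, ← mul_assoc, show (2 : ℝ) * 2 = 4 by norm_num, Finset.sum_filter]
  exact congrArg _ (Finset.sum_congr rfl fun p _ => (ite_and _ _ _ _).symm)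

/-! ### The block field in normal form -/

variable {M : ℕ} (V : GaugeConfig 4 (2 * M) (Matrix.unitaryGroup (Fin 3) ℂ)) (c : Site 4 (2 * M))

/-- The representatives `c + a`, `a ∈ (ℤ/2)⁴`, have all coordinates in `{c_ν, c_ν + 1}`. -/
theorem rep_cases (a : Fin 4 → ZMod 2) (ν : Fin 4) :
    c ν + (((a ν).val : ℕ) : ZMod (2 * M)) = c ν ∨
      c ν + (((a ν).val : ℕ) : ZMod (2 * M)) = c ν + 1 := by
  rcases (by decide : ∀ z : ZMod 2, z = 0 ∨ z = 1) (a ν) with h | h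
  · left
    rw [h, ZMod.val_zero, Nat.cast_zero, add_zero]
  · right
    rw [h, ZMod.val_one, Nat.cast_one]

/-- `c + (a + μ̂) = (c + a) + μ̂` when `a_μ = 0` (no wrap in `ℤ/2`). -/
theorem rep_shift {a : Fin 4 → ZMod 2} {μ : Fin 4} (h : a μ = 0) :
    (fun ν => c ν + (((Site.shift a μ ν).val : ℕ) : ZMod (2 * M))) =
      Site.shift (fun ν => c ν + (((a ν).val : ℕ) : ZMod (2 * M))) μ := by
  funext ν
  by_cases hν : ν = μ
  · subst hν
    simp only [FreeDetFormula.shift_apply_self, h, zero_add, ZMod.val_zero, Nat.cast_zero, add_zero,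
      ZMod.val_one, Nat.cast_one]
  · rw [FreeDetFormula.shift_apply_of_ne _ hν, FreeDetFormula.shift_apply_of_ne _ hν]

/-- **Part (i).**  A block field in normal form satisfies `W (x + μ̂, μ) = W (x, μ)⁻¹`. -/
theorem link_shift
    (hW : ∀ (a : Fin 4 → ZMod 2) (μ : Fin 4), W (a, μ) =
      if a μ = 0 then V (fun ν => c ν + (((a ν).val : ℕ) : ZMod (2 * M)), μ)
      else (V (fun ν => c ν +
        ((((a + Pi.single μ 1 : Fin 4 → ZMod 2) ν).val : ℕ) : ZMod (2 * M)), μ))⁻¹)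
    (x : TorusSite 4 2) (μ : Fin 4) : W (Site.shift x μ, μ) = (W (x, μ))⁻¹ := by
  rw [hW, hW x μ, FreeDetFormula.shift_apply_self]
  by_cases h : x μ = 0
  · rw [if_neg (by rw [h]; decide), if_pos h,
      show (Site.shift x μ + Pi.single μ 1 : Fin 4 → ZMod 2) = x from shift_shift_self x μ]
  · rw [if_pos ((by decide : ∀ z : ZMod 2, ¬z = 0 → z + 1 = 0) _ h), if_neg h, inv_inv]
    rfl

/-- **Base case of part (ii).**  For `a_i = a_j = 0` (`i ≠ j`) the block holonomy at `a` in the plane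
`(i, j)` is the cell holonomy of `V` at `c + a`. -/
theorem holonomy_base
    (hW : ∀ (a : Fin 4 → ZMod 2) (μ : Fin 4), W (a, μ) =
      if a μ = 0 then V (fun ν => c ν + (((a ν).val : ℕ) : ZMod (2 * M)), μ)
      else (V (fun ν => c ν +
        ((((a + Pi.single μ 1 : Fin 4 → ZMod 2) ν).val : ℕ) : ZMod (2 * M)), μ))⁻¹)
    {a : Fin 4 → ZMod 2} {i j : Fin 4} (hij : i ≠ j) (hi : a i = 0) (hj : a j = 0) :
    plaquetteHolonomy W a i j =
      plaquetteHolonomy V (fun ν => c ν + (((a ν).val : ℕ) : ZMod (2 * M))) i j := by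
  have hsi : Site.shift a i j = 0 := by rw [FreeDetFormula.shift_apply_of_ne a hij.symm, hj]
  have hsj : Site.shift a j i = 0 := by rw [FreeDetFormula.shift_apply_of_ne a hij, hi]
  unfold plaquetteHolonomy
  rw [hW a i, if_pos hi, hW (Site.shift a i) j, if_pos hsi, hW (Site.shift a j) i, if_pos hsj, hW a j,
    if_pos hj, rep_shift c hi, rep_shift c hj]

variable [NeZero M]

/-- **The cell plaquettes.**  `(a; i, j) ↦ (c + a; i, j)` is a bijection from the block plaquettes with
`a_i = a_j = 0` onto the cell plaquettes at `c` (given through their membership characterisation;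
injectivity uses `M ≥ 1`). -/
theorem sum_filter_eq_sum_cell (F : Plaquette 4 (2 * M) → ℝ) {S : Finset (Plaquette 4 (2 * M))}
    (hS : ∀ q : Plaquette 4 (2 * M), q ∈ S ↔ (q.1 q.2.1.1 = c q.2.1.1 ∧ q.1 q.2.1.2 = c q.2.1.2 ∧
      ∀ ν, ν ≠ q.2.1.1 → ν ≠ q.2.1.2 → (q.1 ν = c ν ∨ q.1 ν = c ν + 1))) :
    ∑ p ∈ univ.filter (fun p : Plaquette 4 2 => p.1 p.2.1.1 = 0 ∧ p.1 p.2.1.2 = 0),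
        F ((fun ν => c ν + (((p.1 ν).val : ℕ) : ZMod (2 * M))), p.2) =
      ∑ q ∈ S, F q := by
  refine Finset.sum_bij (fun (p : Plaquette 4 2) _ =>
    (((fun ν => c ν + (((p.1 ν).val : ℕ) : ZMod (2 * M))), p.2) : Plaquette 4 (2 * M)))
    ?_ ?_ ?_ fun _ _ => rfl
  · -- lands in the cell plaquettes
    intro p hp
    obtain ⟨h₁, h₂⟩ := (Finset.mem_filter.1 hp).2
    refine (hS _).2 ⟨?_, ?_, fun ν _ _ => rep_cases c p.1 ν⟩
    · show c p.2.1.1 + (((p.1 p.2.1.1).val : ℕ) : ZMod (2 * M)) = c p.2.1.1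
      rw [h₁, ZMod.val_zero, Nat.cast_zero, add_zero]
    · show c p.2.1.2 + (((p.1 p.2.1.2).val : ℕ) : ZMod (2 * M)) = c p.2.1.2
      rw [h₂, ZMod.val_zero, Nat.cast_zero, add_zero]
  · -- injective
    rintro ⟨a, σ⟩ - ⟨b, τ⟩ - h
    simp only [Prod.mk.injEq] at h
    obtain ⟨hab, rfl⟩ := h
    refine Prod.ext (funext fun κ => ?_) rfl
    have hv := congrArg ZMod.val (add_left_cancel (congrFun hab κ))
    rw [ZMod.val_cast_of_lt (TilingCellData.val_lt_two_mul (a κ)),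
      ZMod.val_cast_of_lt (TilingCellData.val_lt_two_mul (b κ))] at hv
    exact ZMod.val_injective 2 hv
  · -- surjective
    rintro ⟨y, σ⟩ hq
    obtain ⟨h₁, h₂, h₃⟩ : y σ.1.1 = c σ.1.1 ∧ y σ.1.2 = c σ.1.2 ∧
        ∀ ν, ν ≠ σ.1.1 → ν ≠ σ.1.2 → (y ν = c ν ∨ y ν = c ν + 1) := (hS _).1 hq
    have ha : ∀ ν, c ν + ((((if y ν = c ν then (0 : ZMod 2) else 1)).val : ℕ) : ZMod (2 * M)) = y ν := by
      intro ν
      by_cases hν : y ν = c ν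
      · rw [if_pos hν, ZMod.val_zero, Nat.cast_zero, add_zero, hν]
      · have hi : ν ≠ σ.1.1 := fun h => hν (by rw [h]; exact h₁)
        have hj : ν ≠ σ.1.2 := fun h => hν (by rw [h]; exact h₂)
        have hy : y ν = c ν + 1 := (h₃ ν hi hj).resolve_left hν
        rw [if_neg hν, hy, ZMod.val_one, Nat.cast_one]
    refine ⟨((fun ν => if y ν = c ν then (0 : ZMod 2) else 1), σ), Finset.mem_filter.2
      ⟨Finset.mem_univ _, ?_, ?_⟩, Prod.ext (funext ha) rfl⟩
    · show (if y σ.1.1 = c σ.1.1 then (0 : ZMod 2) else 1) = 0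
      rw [if_pos h₁]
    · show (if y σ.1.2 = c σ.1.2 then (0 : ZMod 2) else 1) = 0
      rw [if_pos h₂]

/-- **Part (ii).**  For a block field in normal form, the `96` block plaquette deficits sum to four
times the total deficit of the cell plaquettes of `V` at `c`. -/
theorem sum_deficit_eq
    (hW : ∀ (a : Fin 4 → ZMod 2) (μ : Fin 4), W (a, μ) =
      if a μ = 0 then V (fun ν => c ν + (((a ν).val : ℕ) : ZMod (2 * M)), μ)
      else (V (fun ν => c ν +
        ((((a + Pi.single μ 1 : Fin 4 → ZMod 2) ν).val : ℕ) : ZMod (2 * M)), μ))⁻¹)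
    {S : Finset (Plaquette 4 (2 * M))}
    (hS : ∀ q : Plaquette 4 (2 * M), q ∈ S ↔ (q.1 q.2.1.1 = c q.2.1.1 ∧ q.1 q.2.1.2 = c q.2.1.2 ∧
      ∀ ν, ν ≠ q.2.1.1 → ν ≠ q.2.1.2 → (q.1 ν = c ν ∨ q.1 ν = c ν + 1))) :
    ∑ p : Plaquette 4 2,
        (3 - (unitaryFundamentalRep (Fin 3) ℂ (plaquetteHolonomy W p.1 p.2.1.1 p.2.1.2)).trace.re) =
      4 * ∑ q ∈ S, (3 - (unitaryFundamentalRep (Fin 3) ℂ (plaquetteHolonomy V q.1 q.2.1.1 q.2.1.2)).trace.re) := by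
  have hW1 : ∀ (x : Site 4 2) (μ : Fin 4), W (Site.shift x μ, μ) = (W (x, μ))⁻¹ := link_shift V c hW
  calc ∑ p : Plaquette 4 2,
        (3 - (unitaryFundamentalRep (Fin 3) ℂ (plaquetteHolonomy W p.1 p.2.1.1 p.2.1.2)).trace.re)
      = 4 * ∑ p ∈ univ.filter (fun p : Plaquette 4 2 => p.1 p.2.1.1 = 0 ∧ p.1 p.2.1.2 = 0),
          (3 - (unitaryFundamentalRep (Fin 3) ℂ (plaquetteHolonomy W p.1 p.2.1.1 p.2.1.2)).trace.re) :=
        sum_eq_four_mul_sum_filter _ (fun p => deficit_shift_fst hW1 p.1 p.2.1.1 p.2.1.2)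
          fun p => deficit_shift_snd hW1 p.1 p.2.1.1 p.2.1.2
    _ = 4 * ∑ p ∈ univ.filter (fun p : Plaquette 4 2 => p.1 p.2.1.1 = 0 ∧ p.1 p.2.1.2 = 0),
          (3 - (unitaryFundamentalRep (Fin 3) ℂ (plaquetteHolonomy V
            (fun ν => c ν + (((p.1 ν).val : ℕ) : ZMod (2 * M))) p.2.1.1 p.2.1.2)).trace.re) := by
        congr 1
        refine Finset.sum_congr rfl fun p hp => ?_
        obtain ⟨h₁, h₂⟩ := (Finset.mem_filter.1 hp).2
        rw [holonomy_base V c hW (ne_of_lt p.2.2) h₁ h₂]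
    _ = 4 * ∑ q ∈ S,
          (3 - (unitaryFundamentalRep (Fin 3) ℂ (plaquetteHolonomy V q.1 q.2.1.1 q.2.1.2)).trace.re) :=
        congrArg (fun t : ℝ => 4 * t) (sum_filter_eq_sum_cell c (fun q : Plaquette 4 (2 * M) =>
          3 - (unitaryFundamentalRep (Fin 3) ℂ (plaquetteHolonomy V q.1 q.2.1.1 q.2.1.2)).trace.re) hS)

end TilingCombinatorics

/-- **Stub `stub_tilingCombinatorics` (the reflection tiling read on the `2⁴` block).**  For the cell
field `W_c` of the period-2 reflection tiling `tile_c V` read at the representatives `c + a`,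
`a ∈ (ℤ/2)⁴`, on the even torus `(ℤ/2M)⁴`: (i) `W_c (x + μ̂, μ) = W_c (x, μ)⁻¹`; (ii) the `96` plaquette
deficits of `W_c` on the `2⁴`-torus sum to `4` times the total deficit of the cell plaquettes of `V`
at `c` (`TilingCombinatorics.link_shift`, `TilingCombinatorics.sum_deficit_eq`, from the normal form
`TilingCellData.link_eq`). -/
theorem stub_tilingCombinatorics : ∀ (M : ℕ) [NeZero M] (V : GaugeConfig 4 (2 * M) (Matrix.unitaryGroup (Fin 3) ℂ)) (c : Site 4 (2 * M)), let tile : Site 4 (2 * M) → GaugeConfig 4 (2 * M) (Matrix.unitaryGroup (Fin 3) ℂ) → GaugeConfig 4 (2 * M) (Matrix.unitaryGroup (Fin 3) ℂ) := fun c V e => if (e.1 e.2 - c e.2).val % 2 = 0 then V (fun ν => c ν + (((e.1 ν - c ν).val % 2 : ℕ) : ZMod (2 * M)), e.2) else (V (fun ν => c ν + (((Site.shift e.1 e.2 ν - c ν).val % 2 : ℕ) : ZMod (2 * M)), e.2))⁻¹; let Wc : GaugeConfig 4 2 (Matrix.unitaryGroup (Fin 3) ℂ) := fun e => tile c V (fun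 ν => c ν + (((e.1 ν).val : ℕ) : ZMod (2 * M)), e.2); (∀ (x : TorusSite 4 2) (μ : Fin 4), Wc (Site.shift x μ, μ) = (Wc (x, μ))⁻¹) ∧ ∑ p : Plaquette 4 2, (3 - (unitaryFundamentalRep (Fin 3) ℂ (plaquetteHolonomy Wc p.1 p.2.1.1 p.2.1.2)).trace.re) = 4 * ∑ p ∈ univ.filter (fun p : Plaquette 4 (2 * M) => p.1 p.2.1.1 = c p.2.1.1 ∧ p.1 p.2.1.2 = c p.2.1.2 ∧ ∀ ν, ν ≠ p.2.1.1 → ν ≠ p.2.1.2 → (p.1 ν = c ν ∨ p.1 ν = c ν + 1)), (3 - (unitaryFundamentalRep (Fin 3) ℂ (plaquetteHolonomy V p.1 p.2.1.1 p.2.1.2)).trace.re) := by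
  intro M _ V c tile Wc
  have hW : ∀ (a : Fin 4 → ZMod 2) (μ : Fin 4), Wc (a, μ) =
      if a μ = 0 then V (fun ν => c ν + (((a ν).val : ℕ) : ZMod (2 * M)), μ)
      else (V (fun ν => c ν +
        ((((a + Pi.single μ 1 : Fin 4 → ZMod 2) ν).val : ℕ) : ZMod (2 * M)), μ))⁻¹ :=
    fun a μ => TilingCellData.link_eq V c (T := tile c V) (fun _ _ => rfl) a μ
  exact ⟨TilingCombinatorics.link_shift V c hW, TilingCombinatorics.sum_deficit_eq V c hW fun q => by
    simp only [Finset.mem_filter, Finset.mem_univ, true_and]⟩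

end Summit.QuantumFields.QCD.Cruxes.CriticalLineDiamagnetism.ChessboardCellGain

end
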